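import Mathlib
import Summits.BirchSwinnertonDyer.BirchSwinnertonDyer.Theorems.ResidualThetaTransportAtTwoSignedMuSeedAtTwoPlusNonsquareDescentMuCriterion
import HarnessLib

/-!
# Non-square descent — THE INDEX-PARITY SHADOW `¬GNS(m) ⇒ #(𝒪/2)^{rank} ∣ #B'_m` (sub-approach (γ) of stub S4 and the converse bound of S3
# in the line card `nonsquare-descent`) for the seed crux `SignedMuSeedAtTwoPlus` stmt-BirchSwinnertonDyer-21438
# (parent Kμ⁺ `SignedMuVanishingAtTwoPlus` stmt-BirchSwinnertonDyer-20689, route ResidualThetaTransportAtTwo)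

Cell `bsd-wall`, width seat `bsd-wall-rtt-p4-w2` g17 (`--supports`, closes nothing).  THEOREMS ONLY; BSD is not proved by this; nothing
arithmetic is asserted.

`Cruxes/SignedMuSeedAtTwoPlus/Lines/nonsquare-descent.md` S3/S4 (γ): «`¬GNS(m) ⟹ u_m ∈ 2𝓔_m^χ ⟹ #B'_m ≥ 4^{2^m}` (then, by the index theorem,
`ord₂ h(L_m) ≥ 2^m − C_m`)».  The module algebra: `𝓔_m^χ` is `𝒪`-free of rank `2^m` (`𝒪 = ℤ₂[ζ₃]`, `#𝒪/2 = 4`), so `#(𝓔_m^χ/2) = 4^{2^m}`, and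
`u_m ∈ 2𝓔_m^χ` makes `B'_m = 𝓔_m^χ/𝒪[G_m]u_m` surject onto `𝓔_m^χ/2` (`Theorems/…NonsquareDescentMuCriterion.lean`,
`natCard_quotient_smul_top_dvd_of_mem`).  Here:

* §1 `smul_top_self_eq_span`, `smul_top_pi_eq_pi`, `natCard_pi_quotient_smul_top`, **`natCard_quotient_smul_top_of_linearEquiv`** — for an
  `𝒪`-module `E` with `E ≃ₗ[𝒪] (Fin r → 𝒪)`: `#(E/ϖE) = #(𝒪/ϖ𝒪)^r`.
* §2 `restrictScalars_algebraMap_smul_top`, `natCard_quotient_algebraMap_smul_top` — the same quotient seen over an `𝒪`-algebra `R` (`Λ'` or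
  `𝒪[G_m]`) acting on `E` compatibly.
* §3 **`pow_natCard_dvd_natCard_quotient_span`** — `u ∈ ϖE ⇒ #(𝒪/ϖ)^r ∣ #(E ⧸ R∙u)`: «`¬GNS(m) ⟹ 4^{2^m} ∣ #B'_m`» once `E = 𝓔_m^χ` is fed as
  `𝒪`-free of rank `2^m` and `R∙u = 𝒪[G_m]u_m`; `pow_natCard_dvd_natCard_quotient_span_of_eq_smul` (hypothesis `u = ϖ • y`).
* §4 (appended) **the census reading rule (C4) of the card, «GNS(m) ⟸ ord₂ h(L_m) < 2^m − C_m»**, as `p`-adic bookkeeping: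
  `mul_le_add_two_mul_padicValNat_of_dvd` (`p^{f r} ∣ B ∣ p^c·h² ⇒ f r ≤ c + 2 v_p(h)`) and
  **`not_mem_smul_top_of_padicValNat_lt`** — if `#(𝒪/ϖ) = p^f`, `E` is `𝒪`-free of rank `r`, `#(E ⧸ R∙u) ∣ p^c · h²` (the index theorem
  + `#A(M_m)^χ = #A(L_m)[2^∞]²`, fed as a hypothesis) and `c + 2 v_p(h) < f·r`, then `u ∉ ϖE` (i.e. GNS(m)).

[folklore]
-/

set_option autoImplicit false
-- the Theorems namespace of this sub repeats the summit name by design (D-0017 nested layout)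
set_option linter.dupNamespace false

open scoped Pointwise

namespace Summit.BirchSwinnertonDyer.BirchSwinnertonDyer.Theorems.SignedMuAtTwo.NonsquareDescent

/-! ## §1 `#(E/ϖE) = #(𝒪/ϖ)^r` for `E` free of rank `r` -/

section Free

variable {𝒪 : Type*} [CommRing 𝒪]

/-- `ϖ • 𝒪 = (ϖ)` as submodules of `𝒪`. [folklore] -/
theorem smul_top_self_eq_span (ϖ : 𝒪) : (ϖ • (⊤ : Submodule 𝒪 𝒪)) = Ideal.span {ϖ} := by
  ext x
  rw [Submodule.mem_smul_pointwise_iff_exists, Ideal.mem_span_singleton']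
  constructor
  · rintro ⟨b, -, rfl⟩
    exact ⟨b, by rw [smul_eq_mul, mul_comm]⟩
  · rintro ⟨b, rfl⟩
    exact ⟨b, Submodule.mem_top, by rw [smul_eq_mul, mul_comm]⟩

/-- `ϖ • (Fin r → 𝒪)` is the product submodule `∏ ϖ𝒪`. [folklore] -/
theorem smul_top_pi_eq_pi (ϖ : 𝒪) (r : ℕ) :
    (ϖ • (⊤ : Submodule 𝒪 (Fin r → 𝒪)))
      = Submodule.pi Set.univ (fun _ : Fin r => ϖ • (⊤ : Submodule 𝒪 𝒪)) := by
  ext x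
  rw [Submodule.mem_smul_pointwise_iff_exists, Submodule.mem_pi]
  constructor
  · rintro ⟨y, -, rfl⟩ i -
    exact (Submodule.mem_smul_pointwise_iff_exists _ _ _).mpr ⟨y i, Submodule.mem_top, rfl⟩
  · intro h
    have h' : ∀ i : Fin r, ∃ c : 𝒪, ϖ • c = x i := fun i => by
      obtain ⟨c, -, hc⟩ := (Submodule.mem_smul_pointwise_iff_exists _ _ _).mp (h i (Set.mem_univ i))
      exact ⟨c, hc⟩
    choose c hc using h'
    exact ⟨c, Submodule.mem_top, funext fun i => by rw [Pi.smul_apply, hc i]⟩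

/-- `#((Fin r → 𝒪)/ϖ) = #(𝒪/ϖ𝒪)^r`. [folklore] -/
theorem natCard_pi_quotient_smul_top (ϖ : 𝒪) (r : ℕ) :
    Nat.card ((Fin r → 𝒪) ⧸ (ϖ • (⊤ : Submodule 𝒪 (Fin r → 𝒪))))
      = Nat.card (𝒪 ⧸ (ϖ • (⊤ : Submodule 𝒪 𝒪))) ^ r := by
  classical
  rw [Nat.card_congr (Submodule.quotEquivOfEq _ _ (smul_top_pi_eq_pi ϖ r)).toEquiv,
    Nat.card_congr (Submodule.quotientPi (fun _ : Fin r => ϖ • (⊤ : Submodule 𝒪 𝒪))).toEquiv,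
    Nat.card_fun, Nat.card_eq_fintype_card (α := Fin r), Fintype.card_fin]

/-- **`#(E/ϖE) = #(𝒪/ϖ)^r` for `E` free of rank `r` over `𝒪`** (given a basis isomorphism `E ≃ₗ[𝒪] (Fin r → 𝒪)`). [folklore] -/
theorem natCard_quotient_smul_top_of_linearEquiv {E : Type*} [AddCommGroup E] [Module 𝒪 E] {r : ℕ}
    (e : E ≃ₗ[𝒪] (Fin r → 𝒪)) (ϖ : 𝒪) :
    Nat.card (E ⧸ (ϖ • (⊤ : Submodule 𝒪 E))) = Nat.card (𝒪 ⧸ Ideal.span {ϖ}) ^ r := by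
  have hmap : (ϖ • (⊤ : Submodule 𝒪 E)).map (e : E →ₗ[𝒪] (Fin r → 𝒪))
      = ϖ • (⊤ : Submodule 𝒪 (Fin r → 𝒪)) := by
    rw [Submodule.map_pointwise_smul, Submodule.map_top, LinearEquiv.range]
  rw [Nat.card_congr (Submodule.Quotient.equiv _ _ e hmap).toEquiv, natCard_pi_quotient_smul_top,
    smul_top_self_eq_span]

end Free

/-! ## §2 The same quotient over an `𝒪`-algebra `R` acting compatibly -/

section Tower

variable {𝒪 R E : Type*} [CommRing 𝒪] [CommRing R] [Algebra 𝒪 R] [AddCommGroup E] [Module R E] [Module 𝒪 E]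
  [IsScalarTower 𝒪 R E]

/-- `(algebraMap ϖ) • E` over `R` restricts to `ϖ • E` over `𝒪`. [folklore] -/
theorem restrictScalars_algebraMap_smul_top (ϖ : 𝒪) :
    ((algebraMap 𝒪 R ϖ) • (⊤ : Submodule R E)).restrictScalars 𝒪 = ϖ • (⊤ : Submodule 𝒪 E) := by
  ext x
  rw [Submodule.restrictScalars_mem, Submodule.mem_smul_pointwise_iff_exists,
    Submodule.mem_smul_pointwise_iff_exists]
  constructor
  · rintro ⟨y, -, rfl⟩
    exact ⟨y, Submodule.mem_top, (algebraMap_smul R ϖ y).symm⟩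
  · rintro ⟨y, -, rfl⟩
    exact ⟨y, Submodule.mem_top, algebraMap_smul R ϖ y⟩

/-- `#(E ⧸ (algebraMap ϖ)E)` (over `R`) `= #(E ⧸ ϖE)` (over `𝒪`). [folklore] -/
theorem natCard_quotient_algebraMap_smul_top (ϖ : 𝒪) :
    Nat.card (E ⧸ ((algebraMap 𝒪 R ϖ) • (⊤ : Submodule R E)))
      = Nat.card (E ⧸ (ϖ • (⊤ : Submodule 𝒪 E))) := by
  rw [← Nat.card_congr (Submodule.Quotient.restrictScalarsEquiv 𝒪
      ((algebraMap 𝒪 R ϖ) • (⊤ : Submodule R E))).toEquiv,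
    Nat.card_congr (Submodule.quotEquivOfEq _ _ (restrictScalars_algebraMap_smul_top (R := R) (E := E) ϖ)).toEquiv]

/-! ## §3 `¬GNS(m) ⟹ #(𝒪/2)^{2^m} ∣ #B'_m` -/

/-- **`u ∈ ϖE ⇒ #(𝒪/ϖ)^r ∣ #(E ⧸ R∙u)`** for `E` free of rank `r` over `𝒪` and `R` an `𝒪`-algebra acting compatibly: the card's
«`¬GNS(m) ⟹ u_m ∈ 2𝓔_m^χ ⟹ #B'_m ≥ 4^{2^m}`» (with `𝒪 = ℤ₂[ζ₃]`, `ϖ = 2`, `r = 2^m`, `R∙u = 𝒪[G_m]u_m`). [folklore] -/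
theorem pow_natCard_dvd_natCard_quotient_span {r : ℕ} (e : E ≃ₗ[𝒪] (Fin r → 𝒪)) (ϖ : 𝒪) {u : E}
    (hu : u ∈ (algebraMap 𝒪 R ϖ) • (⊤ : Submodule R E)) :
    Nat.card (𝒪 ⧸ Ideal.span {ϖ}) ^ r ∣ Nat.card (E ⧸ Submodule.span R {u}) := by
  rw [← natCard_quotient_smul_top_of_linearEquiv e ϖ, ← natCard_quotient_algebraMap_smul_top (R := R)]
  exact natCard_quotient_smul_top_dvd_of_mem hu

/-- Variant with the hypothesis `u = ϖ • y` (`u_m = 2·y` in `𝓔_m^χ`, as observed in the toy `NonsquareDescentToy.md` for 406203s1 at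
`m = 0, 1, 2`). [folklore] -/
theorem pow_natCard_dvd_natCard_quotient_span_of_eq_smul {r : ℕ} (e : E ≃ₗ[𝒪] (Fin r → 𝒪)) (ϖ : 𝒪)
    {u y : E} (hu : u = ϖ • y) :
    Nat.card (𝒪 ⧸ Ideal.span {ϖ}) ^ r ∣ Nat.card (E ⧸ Submodule.span R {u}) := by
  refine pow_natCard_dvd_natCard_quotient_span e ϖ ?_
  exact (Submodule.mem_smul_pointwise_iff_exists _ _ _).mpr ⟨y, Submodule.mem_top, by rw [algebraMap_smul, hu]⟩

end Tower

/-! ## §4 The census reading rule (C4): `GNS(m) ⟸ ord₂ h(L_m) < 2^m − C_m` -/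

section Reading

/-- `p^{f r} ∣ B` and `B ∣ p^c · h²` (`h ≠ 0`) give `f r ≤ c + 2 v_p(h)`. [folklore] -/
theorem mul_le_add_two_mul_padicValNat_of_dvd {p : ℕ} [hp : Fact p.Prime] {f r c h B : ℕ} (hh : h ≠ 0)
    (h1 : p ^ (f * r) ∣ B) (h2 : B ∣ p ^ c * h ^ 2) : f * r ≤ c + 2 * padicValNat p h := by
  have hne : p ^ c * h ^ 2 ≠ 0 := mul_ne_zero (pow_ne_zero _ hp.out.ne_zero) (pow_ne_zero _ hh)
  have hle := (padicValNat_dvd_iff_le hne).mp (h1.trans h2)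
  rwa [padicValNat.mul (pow_ne_zero _ hp.out.ne_zero) (pow_ne_zero _ hh), padicValNat.prime_pow,
    padicValNat.pow] at hle

variable {𝒪 R E : Type*} [CommRing 𝒪] [CommRing R] [Algebra 𝒪 R] [AddCommGroup E] [Module R E] [Module 𝒪 E]
  [IsScalarTower 𝒪 R E]

/-- **The reading rule (C4): `c + 2 v_p(h) < f·r ⇒ u ∉ ϖE` (GNS(m)).**  Here `#(𝒪/ϖ) = p^f` (`4 = 2²` for `𝒪 = ℤ₂[ζ₃]`), `E` (`𝓔_m^χ`) is
`𝒪`-free of rank `r` (`2^m`), `#(E ⧸ R∙u)` (`#B'_m`) divides `p^c · h²` (the index theorem with its level constant `c = C_m`, and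
`#A(M_m)^χ = #A(L_m)[2^∞]²` with `h = h(L_m)` — an arithmetic input fed as a hypothesis), `h ≠ 0`.  Contrapositive of
`pow_natCard_dvd_natCard_quotient_span` + `mul_le_add_two_mul_padicValNat_of_dvd`. [folklore] -/
theorem not_mem_smul_top_of_padicValNat_lt {p : ℕ} [Fact p.Prime] {f r c h : ℕ} (e : E ≃ₗ[𝒪] (Fin r → 𝒪)) (ϖ : 𝒪)
    (hq : Nat.card (𝒪 ⧸ Ideal.span {ϖ}) = p ^ f) {u : E} (hh : h ≠ 0)
    (hB : Nat.card (E ⧸ Submodule.span R {u}) ∣ p ^ c * h ^ 2) (hlt : c + 2 * padicValNat p h < f * r) :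
    u ∉ (algebraMap 𝒪 R ϖ) • (⊤ : Submodule R E) := by
  intro hu
  have h1 := pow_natCard_dvd_natCard_quotient_span (R := R) e ϖ hu
  rw [hq, ← pow_mul] at h1
  have hle := mul_le_add_two_mul_padicValNat_of_dvd hh h1 hB
  omega

end Reading

end Summit.BirchSwinnertonDyer.BirchSwinnertonDyer.Theorems.SignedMuAtTwo.NonsquareDescent
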